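import Summits.Ventures.Crystal3D.Theorems.StickyWulffConstantTextureBuildCoplanarFacets
import Summits.Ventures.Crystal3D.Theorems.StickyWulffConstantPolycrystalWulffBoundFacetAreaSymm
import Summits.Ventures.Crystal3D.Theorems.StickyWulffConstantPolycrystalWulffBoundMinkowskiUpper
import HarnessLib

/-!
# TB-D assembly, part 7a: CONTACT ADDITIVITY FROM BOTH SIDES — the traces of all other pieces on one facet of a piece add up
# (lane T, crux `TextureLiminfV5`, stmt-Ventures-23912; repair census HOME/wulff-p2/g20/TB-D-1-g20.md §2(d), brick B1)

HONEST FRAMING. Venture `Summits/Ventures/Crystal3D` (cell `crystal3d-full`), route `route-Ventures-StickyWulffConstant`, helper `--supports` the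
law-v5 crux `TextureLiminfV5` (stmt-Ventures-23912).  Pure continuum bookkeeping (census-free, standard axioms) for the LEDGER-SPLITTING theorem of the
`PieceData` construction behind `stub_TB_energy` (part 7b): nothing about any cover or mesh; F-C1 not moved.

THE POINT.  The piece ledger (`energy_le_pieceLedger`, …TextureBuildPieceEnergy) books, for a piece `P = polytope H`, a facet `p ∈ H` and every OTHER
piece `P'`, the contact `cl P ∩ {⟪p.1,x⟫ = p.2} ∩ cl P'`.  To charge these contacts to a DESIGNATED planar region `R` on the facet's plane one needs
`Σ_{P' ≠ P} facetArea (cl P ∩ {⟪p.1,x⟫ = p.2} ∩ cl P' ∩ R) ≤ facetArea R` for an ARBITRARY disjoint family — the other pieces may lie on either side of the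
plane or straddle it away from the facet.  …TextureBuildCoplanarFacets (p711205) proves additivity for pieces on ONE side
(`sum_facetArea_inter_le_of_sameSide`).  Here:
* `mem_closure_clip_of_generic` — at a GENERIC point `y` of the facet (strictly inside every other defining half-space of `H`), a disjoint piece `P'`
  whose closure contains `y` still has `y` in the closure of its FAR-SIDE CLIP `P' ∩ {⟪p.1,x⟫ > p.2} = polytope (insert (−p.1, −p.2) H')` (else an open
  bit of `P'` near `y` would lie in the near open half-space, which near a generic facet point IS `P`);
* `facetArea_nonGeneric_eq_zero` — the non-generic points of the facet lie on finitely many OTHER planes of `H`, a `facetArea`-null set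
  (`facetArea_eq_zero_of_subset_two_planes`);
* **`sum_facetArea_contact_le`** — the displayed inequality, by clipping every other piece to the far side and `sum_facetArea_inter_le_of_sameSide`
  there (normal `−p.1`; `facetArea_neg` converts back).
-/

noncomputable section

namespace Summit.Ventures.Crystal3D.Cruxes.TextureLiminf.TexShadow

open Summit.Ventures.Crystal3D Summit.Ventures.Crystal3D.Theorems MeasureTheory Set
open scoped InnerProductSpace

/-! ### The far-side clip of a piece -/

/-- A point of the closure of a piece satisfies every closed defining constraint. -/
theorem inner_le_of_mem_closure_polytope (H : Finset (E3 × ℝ)) {x : E3} (hx : x ∈ closure (polytope H))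
    (q : E3 × ℝ) (hq : q ∈ H) : ⟪q.1, x⟫_ℝ ≤ q.2 := by
  have hcl : closure (polytope H) ⊆ {x : E3 | ⟪q.1, x⟫_ℝ ≤ q.2} :=
    closure_minimal (fun y hy => by
      simp only [polytope, mem_iInter, mem_setOf_eq] at hy
      exact (hy q hq).le) (isClosed_le (continuous_const.inner continuous_id) continuous_const)
  exact hcl hx

/-- The far-side clip `polytope (insert (−ν, −b) H')` is `polytope H' ∩ {⟪ν, x⟫ > b}`. -/
theorem polytope_insert_neg (H' : Finset (E3 × ℝ)) (ν : E3) (b : ℝ) :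
    polytope (insert (-ν, -b) H') = polytope H' ∩ {x : E3 | b < ⟪ν, x⟫_ℝ} := by
  ext x
  simp only [polytope, Finset.set_biInter_insert, mem_inter_iff, mem_setOf_eq, inner_neg_left, neg_lt_neg_iff, mem_iInter]
  tauto

/-- The far-side clip lies in the far open half-space (written with the normal `−ν`). -/
theorem polytope_insert_neg_subset (H' : Finset (E3 × ℝ)) (ν : E3) (b : ℝ) :
    polytope (insert (-ν, -b) H') ⊆ {x : E3 | ⟪-ν, x⟫_ℝ < -b} := by
  intro x hx
  rw [polytope_insert_neg] at hx
  simpa only [mem_setOf_eq, inner_neg_left, neg_lt_neg_iff] using hx.2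

/-- The far-side clip is a subset of the piece. -/
theorem polytope_insert_neg_subset_self (H' : Finset (E3 × ℝ)) (ν : E3) (b : ℝ) :
    polytope (insert (-ν, -b) H') ⊆ polytope H' := by
  rw [polytope_insert_neg]; exact inter_subset_left

/-- **At a generic facet point, a touching disjoint piece touches from the far side.**  `y` lies on the facet plane `p` of `P = polytope H`,
strictly inside every other defining half-space of `H`, and in the closure of a piece `P'` disjoint from `P`; then `y` is in the closure of the
far-side clip of `P'`. -/
theorem mem_closure_clip_of_generic {H H' : Finset (E3 × ℝ)} (hd : Disjoint (polytope H) (polytope H'))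
    {p : E3 × ℝ} (hp1 : ‖p.1‖ = 1) {y : E3}
    (hgen : ∀ p' ∈ H, p' ≠ p → ⟪p'.1, y⟫_ℝ < p'.2) (hy' : y ∈ closure (polytope H')) :
    y ∈ closure (polytope (insert (-p.1, -p.2) H')) := by
  classical
  -- a radius inside which all OTHER constraints of `H` hold strictly
  have hstrict : ∀ᶠ x in nhds y, ∀ p' ∈ H.erase p, ⟪p'.1, x⟫_ℝ < p'.2 := by
    rw [Filter.eventually_all_finset]
    intro p' hp'
    have hlt := hgen p' (Finset.mem_of_mem_erase hp') (Finset.ne_of_mem_erase hp')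
    exact (isOpen_lt (continuous_const.inner continuous_id) continuous_const).mem_nhds hlt
  obtain ⟨ε, hε, hball⟩ := Metric.eventually_nhds_iff_ball.1 hstrict
  rw [Metric.mem_closure_iff]
  intro δ hδ
  -- a point of `P'` close to `y`
  obtain ⟨x, hx, hxy⟩ := Metric.mem_closure_iff.1 hy' (min ε δ / 2) (by positivity)
  -- an open ball around `x` inside `P' ∩ ball y (min ε δ)`
  have hPo : IsOpen (polytope H') := by
    unfold polytope
    exact isOpen_biInter_finset fun q _ => isOpen_lt (continuous_const.inner continuous_id) continuous_const
  have hxball : x ∈ Metric.ball y (min ε δ) := by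
    rw [Metric.mem_ball, dist_comm]; linarith [min_le_left ε δ, min_le_right ε δ, lt_min hε hδ]
  obtain ⟨r, hr, hrsub⟩ := Metric.isOpen_iff.1 (hPo.inter Metric.isOpen_ball) x ⟨hx, hxball⟩
  -- move `x` a little against `p.1`
  set x' : E3 := x - (r / 2) • p.1 with hx'
  have hx'mem : x' ∈ polytope H' ∩ Metric.ball y (min ε δ) := by
    apply hrsub
    rw [Metric.mem_ball, hx', dist_eq_norm, sub_sub_cancel_left, norm_neg, norm_smul, hp1, mul_one, Real.norm_eq_abs,
      abs_of_pos (by positivity)]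
    linarith
  have hx'P' : x' ∈ polytope H' := hx'mem.1
  have hx'y : dist x' y < min ε δ := Metric.mem_ball.1 hx'mem.2
  -- `x'` is NOT in `P` (disjointness), so it violates the constraint `p` (all others hold strictly near `y`)
  have hx'others : ∀ p' ∈ H.erase p, ⟪p'.1, x'⟫_ℝ < p'.2 := hball x' (Metric.mem_ball.2 (lt_of_lt_of_le hx'y (min_le_left _ _)))
  have hx'notP : x' ∉ polytope H := fun h => Set.disjoint_left.1 hd h hx'P'
  have hx'p : p.2 ≤ ⟪p.1, x'⟫_ℝ := by
    by_contra hlt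
    push Not at hlt
    apply hx'notP
    unfold polytope
    refine mem_iInter₂.2 fun q hq => ?_
    by_cases hqp : q = p
    · rw [hqp]; exact hlt
    · exact hx'others q (Finset.mem_erase.2 ⟨hqp, hq⟩)
  -- hence `x` is strictly on the far side, i.e. in the clip
  have hxfar : p.2 < ⟪p.1, x⟫_ℝ := by
    have : ⟪p.1, x'⟫_ℝ = ⟪p.1, x⟫_ℝ - r / 2 := by
      rw [hx', inner_sub_right, real_inner_smul_right, real_inner_self_eq_norm_sq, hp1]; ring
    linarith
  refine ⟨x, ?_, by linarith [min_le_right ε δ]⟩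
  rw [polytope_insert_neg]
  exact ⟨hx, hxfar⟩

/-! ### The non-generic part of a facet is null -/

/-- The points of the facet `p` of a bounded piece lying on some OTHER facet plane of the piece form a `facetArea`-null set. -/
theorem facetArea_nonGeneric_eq_zero {H : Finset (E3 × ℝ)} (hbd : Bornology.IsBounded (polytope H))
    (hunit : ∀ q ∈ H, ‖q.1‖ = 1)
    (hplanes : ∀ q ∈ H, ∀ q' ∈ H, q ≠ q' → {x : E3 | ⟪q.1, x⟫_ℝ = q.2} ≠ {x : E3 | ⟪q'.1, x⟫_ℝ = q'.2})
    {p : E3 × ℝ} (hp : p ∈ H) :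
    facetArea {y : E3 | y ∈ closure (polytope H) ∧ ⟪p.1, y⟫_ℝ = p.2 ∧ ∃ p' ∈ H, p' ≠ p ∧ ⟪p'.1, y⟫_ℝ = p'.2} p.1 = 0 := by
  classical
  refine le_antisymm ?_ ENNReal.toReal_nonneg
  have h := facetArea_le_sum_of_subset_iUnion (H.erase p)
    {y : E3 | y ∈ closure (polytope H) ∧ ⟪p.1, y⟫_ℝ = p.2 ∧ ∃ p' ∈ H, p' ≠ p ∧ ⟪p'.1, y⟫_ℝ = p'.2}
    (fun p' => closure (polytope H) ∩ ({x : E3 | ⟪p.1, x⟫_ℝ = p.2} ∩ {x : E3 | ⟪p'.1, x⟫_ℝ = p'.2})) p.1 ?_ ?_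
  · refine h.trans (le_of_eq (Finset.sum_eq_zero fun p' hp' => ?_))
    exact facetArea_eq_zero_of_subset_two_planes (π := p') (hunit p hp) (hunit p' (Finset.mem_of_mem_erase hp'))
      (fun x hx => hx.2) (hplanes p hp p' (Finset.mem_of_mem_erase hp') (Finset.ne_of_mem_erase hp').symm)
  · rintro y ⟨hy, hyp, p', hp', hne, hyp'⟩
    exact mem_iUnion₂.2 ⟨p', Finset.mem_erase.2 ⟨hne, hp'⟩, hy, hyp, hyp'⟩
  · intro p' _
    exact volume_prism_ne_top_of_isBounded hbd _ (fun x hx => hx.1) p.1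

/-! ### Contact additivity from both sides -/

/-- Monotonicity of `facetArea` inside the closure of a bounded set. -/
theorem facetArea_mono_of_subset {A B Q : Set E3} (hQ : Bornology.IsBounded Q) (hB : B ⊆ closure Q) (hAB : A ⊆ B) (ν : E3) :
    facetArea A ν ≤ facetArea B ν := by
  have h := facetArea_le_sum_of_subset_iUnion ({0} : Finset ℕ) A (fun _ => B) ν
    (fun x hx => mem_iUnion₂.2 ⟨0, Finset.mem_singleton_self _, hAB hx⟩)
    (fun _ _ => volume_prism_ne_top_of_isBounded hQ _ hB ν)
  simpa using h

/-- **CONTACT ADDITIVITY FROM BOTH SIDES.**  For a finite family of pairwise disjoint pieces, a piece `i` with bounded `polytope (H i)`, unit normals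
and pairwise distinct facet planes, a facet `p ∈ H i`, and a closed bounded region `R` on the facet plane:
`Σ_{j ≠ i} facetArea (cl P_i ∩ {⟪p.1,x⟫ = p.2} ∩ cl P_j ∩ R) p.1 ≤ facetArea R p.1`. -/
theorem sum_facetArea_contact_le {ι : Type*} [DecidableEq ι] (s : Finset ι) (H : ι → Finset (E3 × ℝ))
    (hd : ∀ i ∈ s, ∀ j ∈ s, i ≠ j → Disjoint (polytope (H i)) (polytope (H j)))
    {i : ι} (hi : i ∈ s) (hbd : Bornology.IsBounded (polytope (H i))) (hunit : ∀ q ∈ H i, ‖q.1‖ = 1)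
    (hplanes : ∀ q ∈ H i, ∀ q' ∈ H i, q ≠ q' → {x : E3 | ⟪q.1, x⟫_ℝ = q.2} ≠ {x : E3 | ⟪q'.1, x⟫_ℝ = q'.2})
    {p : E3 × ℝ} (hp : p ∈ H i) {R : Set E3} (hR : R ⊆ {x : E3 | ⟪p.1, x⟫_ℝ = p.2}) (hRc : IsClosed R)
    (hRb : Bornology.IsBounded R) :
    ∑ j ∈ s.erase i, facetArea (closure (polytope (H i)) ∩ {x : E3 | ⟪p.1, x⟫_ℝ = p.2} ∩ closure (polytope (H j)) ∩ R) p.1 ≤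
      facetArea R p.1 := by
  classical
  have hp1 := hunit p hp
  -- the null set of non-generic facet points
  set N : Set E3 := {y : E3 | y ∈ closure (polytope (H i)) ∧ ⟪p.1, y⟫_ℝ = p.2 ∧ ∃ p' ∈ H i, p' ≠ p ∧ ⟪p'.1, y⟫_ℝ = p'.2} with hN
  have hN0 : facetArea N p.1 = 0 := facetArea_nonGeneric_eq_zero hbd hunit hplanes hp
  -- the far-side clips
  set C : ι → Finset (E3 × ℝ) := fun j => insert (-p.1, -p.2) (H j) with hC
  -- a bounded ambient set for the subadditivity lemmas
  have hQ : Bornology.IsBounded (polytope (H i) ∪ R) := hbd.union hRb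
  have hNQ : N ⊆ closure (polytope (H i) ∪ R) := fun y hy => closure_mono subset_union_left hy.1
  -- split each contact into its clipped part and the null part
  have hsplit : ∀ j ∈ s.erase i,
      facetArea (closure (polytope (H i)) ∩ {x : E3 | ⟪p.1, x⟫_ℝ = p.2} ∩ closure (polytope (H j)) ∩ R) p.1 ≤
        facetArea (closure (polytope (C j)) ∩ R) p.1 + facetArea N p.1 := by
    intro j hj
    -- binary subadditivity, from the finite-cover lemma over `Bool`
    have hsub2 : ∀ {F A B : Set E3}, A ⊆ closure (polytope (H i) ∪ R) → B ⊆ closure (polytope (H i) ∪ R) → F ⊆ A ∪ B →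
        facetArea F p.1 ≤ facetArea A p.1 + facetArea B p.1 := by
      intro F A B hA hB hF
      have h := facetArea_le_sum_of_subset_iUnion (Finset.univ : Finset Bool) F (fun b => cond b A B) p.1 ?_ ?_
      · simpa [Fintype.sum_bool] using h
      · intro x hx
        rcases hF hx with h | h
        · exact mem_iUnion₂.2 ⟨true, Finset.mem_univ _, h⟩
        · exact mem_iUnion₂.2 ⟨false, Finset.mem_univ _, h⟩
      · intro b _
        cases b
        · exact volume_prism_ne_top_of_isBounded hQ _ hB p.1
        · exact volume_prism_ne_top_of_isBounded hQ _ hA p.1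
    refine hsub2 (fun y hy => closure_mono subset_union_right (subset_closure hy.2)) hNQ ?_
    rintro y ⟨⟨⟨hyi, hyp⟩, hyj⟩, hyR⟩
    by_cases hg : ∃ p' ∈ H i, p' ≠ p ∧ ⟪p'.1, y⟫_ℝ = p'.2
    · exact Or.inr ⟨hyi, hyp, hg⟩
    · push Not at hg
      refine Or.inl ⟨?_, hyR⟩
      have hgen : ∀ p' ∈ H i, p' ≠ p → ⟪p'.1, y⟫_ℝ < p'.2 := fun p' hp' hne =>
        lt_of_le_of_ne (inner_le_of_mem_closure_polytope (H i) hyi p' hp') (hg p' hp' hne)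
      exact mem_closure_clip_of_generic (hd i hi j (Finset.mem_of_mem_erase hj) (Finset.ne_of_mem_erase hj).symm) hp1 hgen hyj
  -- the clipped pieces are disjoint and lie on the far side: the one-side additivity applies with the normal `−p.1`
  have hfar : ∀ j ∈ s.erase i, polytope (C j) ⊆ {x : E3 | ⟪-p.1, x⟫_ℝ < -p.2} := fun j _ => polytope_insert_neg_subset (H j) p.1 p.2
  have hdC : ∀ j ∈ s.erase i, ∀ j' ∈ s.erase i, j ≠ j' → Disjoint (polytope (C j)) (polytope (C j')) :=
    fun j hj j' hj' hne => (hd j (Finset.mem_of_mem_erase hj) j' (Finset.mem_of_mem_erase hj') hne).mono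
      (polytope_insert_neg_subset_self _ _ _) (polytope_insert_neg_subset_self _ _ _)
  have hRneg : R ⊆ {x : E3 | ⟪-p.1, x⟫_ℝ = -p.2} := fun x hx => by
    have := hR hx; simp only [mem_setOf_eq] at this ⊢; rw [inner_neg_left, this]
  have hneg1 : ‖-p.1‖ = 1 := by rw [norm_neg, hp1]
  have hsame := sum_facetArea_inter_le_of_sameSide (s.erase i) C hneg1 hfar hdC hRneg hRc hRb
  -- convert the direction `−p.1` back to `p.1`
  have hconv : ∀ S : Set E3, facetArea S (-p.1) = facetArea S p.1 := fun S => facetArea_neg S p.1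
  simp only [hconv] at hsame
  calc ∑ j ∈ s.erase i, facetArea (closure (polytope (H i)) ∩ {x : E3 | ⟪p.1, x⟫_ℝ = p.2} ∩ closure (polytope (H j)) ∩ R) p.1
      ≤ ∑ j ∈ s.erase i, (facetArea (closure (polytope (C j)) ∩ R) p.1 + facetArea N p.1) := Finset.sum_le_sum hsplit
    _ = ∑ j ∈ s.erase i, facetArea (closure (polytope (C j)) ∩ R) p.1 := by simp only [hN0, add_zero]
    _ ≤ facetArea R p.1 := hsame

end Summit.Ventures.Crystal3D.Cruxes.TextureLiminf.TexShadow

end
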